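import Mathlib

/-!
# stub_cmLambdaLower · k4 · g10 — kernel sketch (stub-ideation, technique family 3: assume-the-opposite / small cases)

Helper lemmas and certificates for the idea card `Ideas/stub_cmLambdaLower-k4.md`
(slug `stub-cmlambdalower-k4-g10`).  Nothing here proves BSD, `ResidualSignedLambdaLowerCMAtTwo`
(item 22608) or `ResidualThetaCountLowerPureAtTwo` (item 26074); both stay OPEN.  `import Mathlib` only.

* §A  THE `q = 4` HABITAT ROW (Plan 1): `W = 35a1 = [0,1,1,9,1]`, `K = ℚ(√-35)` (h = 2, 2 inert),
      `g = θ_{ψ₀} ⊂ S₂(Γ₀(1225))`, `T_g = ℚ(√5)`, `λ = (2)` inert, `𝒪 = ℤ₂[(1+√5)/2] = W(𝔽₄)`: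
      `q = #(𝒪/ϖ) = 4`, `e = 1`, `f = 2`, `n = 2`, `S₀ ⊇ {5, 7}`, `s₅ = 1`, `s₇ = 2`, `Σ_g({5,7}) = 0`.
      Certificates: `a₂(W) = 0`, `Δ_W = -42875 = -35³ < 0`, `-35 ≡ 5 (mod 8)`, `x²+x+1` irreducible mod 2,
      `h(-35) = 2` (reduced forms), `𝔭₃` non-principal, the quadratic-residue data behind `a₃(g)² = 5`,
      the `s_ℓ` values in the crux's own formula, and the dead level-prime branch `¬ ‖0 - 1‖ < 1`.
* §B  BORN AT INFINITY (Plan 2): the algebra of the S36(α) injection `m ↦ [h ↦ t(h) • m]` (PROVED),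
      the `decide` certificates `-1 ∉ ⟨ℓ⟩ (mod 2^j)` behind `ℚ_ℓ(μ_{2^∞}) = ℚ_{∞,η}`, and the
      Weil-number lemma «no eigenvalue of `ρ_g(Frob_ℓ)` is a root of unity» (PROVED over `ℂ`), which is
      why `A_g^{G_{ℚ_{ℓ,m}}}` and `H¹(ℚ_{ℓ,m}, A_g)` are finite at every finite layer `m`.
* §C  Prop signatures (words → types) for the two statements of Plan 2 that live over tree carriers;
      stated abstractly here (no tree imports), to be instantiated by the stub prover.
-/

set_option linter.dupNamespace false

namespace Summit.BirchSwinnertonDyer.BirchSwinnertonDyer.Cruxes.ResidualThetaCountLowerPureAtTwo.SideaK4G10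

/-! ## §A  The `q = 4` habitat row: `35a1`, `ℚ(√-35)`, `θ_{ψ₀}` of level `1225`, `𝒪 = W(𝔽₄)` -/

/-- A1. `#W(𝔽₂) = 3` for `W = 35a1 : y² + y = x³ + x² + 9x + 1` (two affine points + ∞), hence
`a₂(W) = 2 + 1 - 3 = 0`: the habitat clause `frobeniusTrace 2 = 0` (`GoodSS W 2`). -/
theorem card_affinePoints_35a1_mod2 :
    (Finset.univ.filter
      (fun p : ZMod 2 × ZMod 2 => p.2 ^ 2 + p.2 = p.1 ^ 3 + p.1 ^ 2 + 9 * p.1 + 1)).card = 2 := by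
  decide

/-- A2. The discriminant of the (globally minimal) model `[0,1,1,9,1]` of `35a1` is `-42875 = -35³ < 0`
(`b₂ = 4`, `b₄ = 18`, `b₆ = 5`, `b₈ = -76`): the habitat clause `Δ_W < 0`, and `ℚ(√Δ_W) = ℚ(√-35)`. -/
theorem discr_35a1 :
    ({ a₁ := 0, a₂ := 1, a₃ := 1, a₄ := 9, a₆ := 1 } : WeierstrassCurve ℤ).Δ = -42875 ∧
    (-42875 : ℤ) = -(35 ^ 3) ∧ (-42875 : ℤ) < 0 := by
  refine ⟨?_, by norm_num, by norm_num⟩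
  norm_num [WeierstrassCurve.Δ, WeierstrassCurve.b₂, WeierstrassCurve.b₄, WeierstrassCurve.b₆,
    WeierstrassCurve.b₈]

/-- A3. `-35 ≡ 5 (mod 8)`: `2` is INERT in `K = ℚ(√-35)` (the theta-partner field must have `2` inert:
`cuspCoeff g 2 = 0`); and `-35 ≡ 1 (mod 3)`, `-35 ≡ 1 (mod 4)·… `: `3` SPLITS in `K`. -/
theorem minus35_mod :
    (-35 : ℤ) % 8 = 5 ∧ (-35 : ℤ) % 3 = 1 ∧ (∃ x : ZMod 3, x ^ 2 = -35) := by
  refine ⟨by decide, by decide, ⟨1, by decide⟩⟩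

/-- A4. `x² + x + 1` (the reduction of `x² - x - 1`, minimal polynomial of `(1+√5)/2`) has no root mod 2:
`2` is INERT in `T_g = ℚ(√5)`, so `T_{g,λ} = ℚ₂(√5) = ℚ₄`, `𝒪 = ℤ₂[(1+√5)/2] = W(𝔽₄)`, `ϖ = 2`,
`q = Nat.card (𝒪 ⧸ span {ϖ}) = 4`, `e = 1`, `f = 2`. -/
theorem no_root_x2x1_mod2 : ∀ x : ZMod 2, x ^ 2 + x + 1 ≠ 0 := by decide

/-- A5. Class number `h(-35) = 2`: the reduced primitive forms `(a,b,c)` of discriminant `-35`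
(`|b| ≤ a ≤ c`, `b ≥ 0` if `|b| = a` or `a = c`; `3a² ≤ 35 ⇒ a ≤ 3`) are exactly `(1,1,9)` and `(3,1,3)`.
Encoded with `b' = b + 3 ∈ [0,6]`. -/
theorem reducedForms_disc_minus35 :
    ((Finset.Icc 1 3 ×ˢ Finset.Icc 0 6 ×ˢ Finset.Icc 1 9).filter
      (fun t : ℕ × ℕ × ℕ =>
        let a : ℤ := t.1; let b : ℤ := (t.2.1 : ℤ) - 3; let c : ℤ := t.2.2
        b ^ 2 - 4 * a * c = -35 ∧ |b| ≤ a ∧ a ≤ c ∧ ((|b| = a ∨ a = c) → 0 ≤ b) ∧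
          Int.gcd (Int.gcd a b) c = 1)) =
      {(1, 4, 9), (3, 4, 3)} := by
  decide

/-- A6. The principal form `x² + xy + 9y²` does not represent `3` (already mod 5: it is `(x+3y)²`
there and `3` is a non-square mod 5), while `(3,1,3)` does: the prime `𝔭₃ ∣ 3` of `K` (3 splits, A3)
is NOT principal, `𝔭₃² = ((1+√-35)/2)` (norm 9).  This is the input for `ψ₀(𝔭₃)² = ε(α)·α`. -/
theorem principalForm_not_rep_three :
    (∀ x y : ZMod 5, x ^ 2 + x * y + 9 * y ^ 2 ≠ 3) ∧ (3 : ℤ) * 1 ^ 2 + 1 * 1 * 0 + 3 * 0 ^ 2 = 3 := by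
  exact ⟨by decide, by norm_num⟩

/-- A7. Quadratic-residue data for `a₃(g)² = 5`.  With `ε = χ_K = χ₅·χ₇` on `(𝓞_K/√-35)ˣ = (ℤ/35)ˣ`
(the unique choice giving trivial nebentypus), `α = (1+√-35)/2 ≡ 2⁻¹ = 18 (mod √-35)`:
`ε(α) = χ₅(18)χ₇(18) = χ₅(3)χ₇(4) = (-1)(+1) = -1`, `ε(3) = χ₅(3)χ₇(3) = (-1)(-1) = +1`, hence
`a₃² = (ψ(𝔭₃)+ψ(𝔭̄₃))² = ε(α)(α+ᾱ) + 2·ε(3)·3 = -1 + 6 = 5`: `T_g = ℚ(√5)` (and `T_ψ = ℚ(√5, √-7)`). -/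
theorem qr_data_level1225 :
    (2 : ZMod 35) * 18 = 1 ∧ (18 : ZMod 5) = 3 ∧ (18 : ZMod 7) = 4 ∧
    (¬ ∃ x : ZMod 5, x ^ 2 = 3) ∧ (∃ x : ZMod 7, x ^ 2 = 4) ∧ (¬ ∃ x : ZMod 7, x ^ 2 = 3) ∧
    ((-1 : ℤ) * 1 + 2 * 1 * 3 = 5) ∧ (1225 = 5 ^ 2 * 7 ^ 2) := by
  refine ⟨by decide, by decide, by decide, by decide, ⟨2, by decide⟩, by decide, by norm_num, by norm_num⟩

/-- A8. The crux's own place-count `s_ℓ = 2 ^ padicValNat 2 ((ℓ²-1)/8)` at `S₀ = {5, 7}`: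
`s₅ = 2⁰ = 1` (`(25-1)/8 = 3`), `s₇ = 2¹ = 2` (`(49-1)/8 = 6`).  Both are level primes (`5, 7 ∣ 1225`)
with `a₅(g) = a₇(g) = 0`, so by A9 they contribute `0` to `Σ_g(S₀)`: the row's bound is `4 ^ d ≤ #𝒮_g`. -/
theorem placeCount_S0_row35 :
    2 ^ padicValNat 2 ((5 ^ 2 - 1) / 8) = 1 ∧ 2 ^ padicValNat 2 ((7 ^ 2 - 1) / 8) = 2 := by
  have h3 : padicValNat 2 3 = 0 := padicValNat.eq_zero_of_not_dvd (by decide)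
  have h6 : padicValNat 2 6 = 1 := by
    have : (6 : ℕ) = 2 * 3 := by norm_num
    rw [this, padicValNat.mul (by decide) (by decide), padicValNat.self (by decide), h3]
  constructor
  · have : (5 ^ 2 - 1) / 8 = 3 := by norm_num
    rw [this, h3]; norm_num
  · have : (7 ^ 2 - 1) / 8 = 6 := by norm_num
    rw [this, h6]; norm_num

/-- A9. THE DEAD BRANCH.  In the crux's `Σ_g(S₀)` a level prime `w ∣ M` contributes
`(if ‖a_w(g) - 1‖ < 1 then 1 else 0)`; a CM newform has `a_w(g) = 0` at every `w ∣ M`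
(potentially good, hence additive, reduction: conductor exponent ≥ 2), and `‖0 - 1‖ = 1` is not `< 1`
in ANY normed division ring.  So for CM `g` the level primes contribute `0` — consistent with BV (k4-g8). -/
theorem levelPrime_branch_dead {F : Type*} [NormedDivisionRing F] : ¬ ‖(0 : F) - 1‖ < 1 := by
  simp

/-! ## §B  Born at infinity: the S₀-local class generator and the finite-layer obstruction -/

/-- B1 (PROVED). The algebra of S36(α): if `t : H →+ R` is onto and `H` acts trivially on the
`R`-module `B`, then `m ↦ (h ↦ t h • m)` is injective (evaluate at any `h` with `t h = 1`).  With
`H = H_η^{ab}`, `R = ℤ₂`, `B = A_g = Cofree ρ F`, `t` = the 2-adic Kummer character of `ℓ`, this is the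
injection `A_g ↪ Hom_cont(H_η, A_g) = H¹(H_η, A_g) = D_{w,c}`. -/
theorem injective_eval_smul {H R B : Type*} [AddCommGroup H] [Ring R] [AddCommGroup B] [Module R B]
    (t : H →+ R) (ht : Function.Surjective t) :
    Function.Injective (fun m : B => fun h : H => t h • m) := by
  intro m m' hmm'
  obtain ⟨h, hh⟩ := ht 1
  have key := congrFun hmm' h
  simpa [hh] using key

/-- B2. `-1 ∉ ⟨ℓ⟩` in `ℤ₂ˣ`, certified modulo `2^j`: `⟨3⟩ = ⟨5⟩ = {1, ·} (mod 8)`, `⟨7⟩ = {1,7} (mod 16)`,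
`⟨23⟩ (mod 16)`, `⟨31⟩ (mod 64)` — each generator squares to `1` and is `≠ -1` at the displayed modulus.
Consequence: `⟨ℓ⟩‾ ≅ ℤ₂` is torsion-free, `ℚ_ℓ(μ_{2^∞})/ℚ_ℓ` is THE unramified `ℤ₂`-extension, i.e.
`ℚ_ℓ(μ_{2^∞}) = ℚ_{∞,η}` and `μ_{2^∞} ⊂ ℚ_{∞,η}`: the Kummer character of `ℓ` is a HOMOMORPHISM
`t : H_η → ℤ₂(1) = ℤ₂` (trivial action), onto because `v(ℓ) = 1` is odd. -/
theorem negOne_not_power_cert :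
    ((3 : ZMod 8) ^ 2 = 1 ∧ (3 : ZMod 8) ≠ -1) ∧ ((5 : ZMod 8) ^ 2 = 1 ∧ (5 : ZMod 8) ≠ -1) ∧
    ((7 : ZMod 16) ^ 2 = 1 ∧ (7 : ZMod 16) ≠ -1) ∧ ((23 : ZMod 16) ^ 2 = 1 ∧ (23 : ZMod 16) ≠ -1) ∧
    ((31 : ZMod 64) ^ 2 = 1 ∧ (31 : ZMod 64) ≠ -1) := by
  decide

/-- B3 (PROVED). WEIL-NUMBER LEMMA: if `|a| ≤ 2√ℓ` (`ℓ ≥ 2`) then no root `α ∈ ℂ` of `X² - aX + ℓ` is a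
root of unity.  Applied to `a = ι'(a_ℓ(g))` (totally real, Ramanujan–Petersson / Hasse bound) under
every complex embedding `ι'`: no eigenvalue of `ρ_g(Frob_ℓ)^N` equals `1` (`N ≥ 1`), so
`A_g^{Frob_ℓ^{N}} ` is FINITE — at every finite layer `ℚ_{ℓ,m}` of `ℚ_{∞,η}` the groups
`A_g(ℚ_{ℓ,m})`, `H¹(ℚ_{ℓ,m}, A_g)`, `H¹(ℚ_{ℓ,m}, T_g)` are finite, while `H¹(ℚ_{∞,η}, A_g) ≅ A_g` (S36(β)):
the S₀-local module is born at infinity. -/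
theorem weilNumber_not_rootOfUnity (ℓ : ℕ) (hℓ : 2 ≤ ℓ) (a : ℝ) (ha : |a| ≤ 2 * Real.sqrt ℓ)
    (α : ℂ) (hα : α ^ 2 - (a : ℂ) * α + (ℓ : ℂ) = 0) (N : ℕ) (hN : N ≠ 0) (hroot : α ^ N = 1) :
    False := by
  have hnorm : ‖α‖ = 1 := Complex.norm_eq_one_of_pow_eq_one hroot hN
  have hxy : α.re * α.re + α.im * α.im = 1 := by
    have h := Complex.normSq_eq_norm_sq α
    rw [hnorm, one_pow, Complex.normSq_apply] at h
    exact h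
  have hre := congrArg Complex.re hα
  have him := congrArg Complex.im hα
  simp [pow_two, Complex.mul_re, Complex.mul_im] at hre him
  have hℓ' : (2 : ℝ) ≤ (ℓ : ℝ) := by exact_mod_cast hℓ
  have hs : Real.sqrt ℓ ^ 2 = (ℓ : ℝ) := Real.sq_sqrt (by positivity)
  have h1 : 0 ≤ 2 * Real.sqrt ℓ + |a| := by positivity
  have ha2 : a ^ 2 ≤ 4 * (ℓ : ℝ) := by
    nlinarith [mul_nonneg (sub_nonneg.mpr ha) h1, sq_abs a, hs]
  by_cases hy : α.im = 0
  · -- real root on the unit circle: `α = ±1`, `a = ±(ℓ+1)`, `|a| = ℓ + 1 > 2√ℓ`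
    have hx2 : α.re * α.re = 1 := by simpa [hy] using hxy
    have hare : a * α.re = 1 + ℓ := by
      simp [hy] at hre
      linarith
    have hasq : a ^ 2 = (1 + (ℓ : ℝ)) ^ 2 := by
      calc a ^ 2 = a ^ 2 * (α.re * α.re) := by rw [hx2, mul_one]
        _ = (a * α.re) ^ 2 := by ring
        _ = (1 + (ℓ : ℝ)) ^ 2 := by rw [hare]
    nlinarith [ha2, hasq, hℓ']
  · -- non-real root: `2·re α = a`, then `ℓ = |α|² = 1`
    have hx : 2 * α.re - a = 0 := by
      have hprod : α.im * (2 * α.re - a) = 0 := by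
        have := him
        ring_nf at this ⊢
        linarith
      rcases mul_eq_zero.mp hprod with h | h
      · exact absurd h hy
      · exact h
    have h4 : a * α.re = 2 * (α.re * α.re) := by
      have : a = 2 * α.re := by linarith
      rw [this]; ring
    have : (ℓ : ℝ) = 1 := by linarith
    linarith

/-! ## §C  Prop signatures for Plan 2 (abstract carriers; the stub prover instantiates them on
`localSubgroupOfEmb κ.kerSubgroup (closureEmb ℚ_ℓ)` and `Cofree ρ F`) -/

/-- C1 (signature). «FINITE-LAYER TWIN IS FALSE»: over a group `G` (think `G_{ℚ_{ℓ,m}}^{ab}`) in which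
every additive character `G → R` kills a given subgroup `I` (inertia: `Hom_cont(G_{ℚ_{ℓ,m}}, ℤ₂)` is
unramified-only, `I^{ab}` being pro-`ℓ` × finite), no character is onto already on `I`; so S36(α)'s `t`
(onto on inertia: the Kummer character of the uniformiser `ℓ`) is NOT the restriction of a level-`m`
character — the constructor must be typed on `H_η = localSubgroupOfEmb κ.kerSubgroup (closureEmb ℚ_ℓ)`. -/
def FiniteLayerTwinFalse (G R : Type*) [AddCommGroup G] [Ring R] (I : AddSubgroup G) : Prop :=
  ∀ χ : G →+ R, (1 : R) ≠ 0 → ¬ Function.Surjective (fun i : I => χ i)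

/-- C1 from the killing hypothesis (the content is in DISCHARGING `hkill` for
`G = G_{ℚ_{ℓ,m}}^{ab} ≅ ℤ̂ × ℤ_ℓˣ`, `R = ℤ₂`, `I` = the image of `ℤ_ℓˣ`). -/
theorem finiteLayerTwinFalse_of_kill (G R : Type*) [AddCommGroup G] [Ring R] (I : AddSubgroup G)
    (hkill : ∀ χ : G →+ R, ∀ i ∈ I, χ i = 0) : FiniteLayerTwinFalse G R I := by
  intro χ h1 hsurj
  obtain ⟨i, hi⟩ := hsurj 1
  exact h1 (by simpa [hkill χ i i.2] using hi.symm)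

/-- C2 (PROVED). «AT INFINITY THE TWIN IS TRUE, and unique»: if `t : H →+ R` is onto, two module elements
with the same character `h ↦ t h • m` are equal, and every character of the form `r ↦ r • m` pulled back
along `t` arises this way — the uniqueness half of `A_g ≅ Hom_cont(H_η, A_g) = D_{w,c}` (S36(β)/V34); the
existence half is the statement that `H_η^{ab,(2)}` is (topologically) cyclic, generated against `t`. -/
theorem existsUnique_of_factor {H R B : Type*} [AddCommGroup H] [Ring R] [AddCommGroup B] [Module R B]
    (t : H →+ R) (ht : Function.Surjective t) (m₀ : B) :
    ∃! m : B, ∀ h : H, t h • m₀ = t h • m := by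
  refine ⟨m₀, fun _ => rfl, fun m hm => ?_⟩
  obtain ⟨h, hh⟩ := ht 1
  have := hm h
  rw [hh, one_smul, one_smul] at this
  exact this.symm

end Summit.BirchSwinnertonDyer.BirchSwinnertonDyer.Cruxes.ResidualThetaCountLowerPureAtTwo.SideaK4G10
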